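import Summits.AtomisticToContinuum.Crystallization.Theses.PricedLinkCensus
import Summits.AtomisticToContinuum.Crystallization.Theorems.PricedLinkCensusTruncatedCensusGapNearOfLocalPricing

/-!
# `TruncatedCensusGap` from its two open cores: far-site pricing and local near pricing

Route `PricedLinkCensus`, crux `TruncatedCensusGap` (stmt-AtomisticToContinuum-14230), line `near-far-split`
(`Cruxes/TruncatedCensusGap/Lines/near_far_split.lean`, lead c5, end of cycle 1).  The line's composition as
an IMPORTABLE theorem: the crux follows from

* **FAR** `BarlowFarSiteGap` — every site whose closed `3a`-patch is not `a/2`-separated and two-way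
  `a/50`-matched to a rigidly moved Barlow stacking of the near-window (`a ∈ [0.93, 1.02]`,
  `c ∈ [0.78a, 0.86a]`, any Hägg word) pays `κ₂ > 0` above `N e_χ*` (finite-range periodic crystallization
  for `V_χ` in coarse priced form; periodic / separated-periodic forms and kill criterion landed p168095,
  p168411) — OPEN;
* **N2′** `LocalNearPricing` — zero-sum, uniformly bounded transfers price every deep-near site at `e_χ*` and
  every charged deep-near site at `e_χ* + κ` (chart-free local pricing; the near half's irreducible content,
  N3 worker's S4–S6 analysis) — OPEN;

by N3′ (`stub_nearOfLocalPricing`, p169781: N2′ → NEAR′), NEAR′ → NEAR (the `Finset` form instantiated with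
the filter of the near predicate) and the near/far glue (`#charged ≤ #(charged ∧ near) + #far`,
`κ := κ₁κ₂/(κ₁ + κ₂ + max C 0)`).  With N1 `strainedBarlowMargin` (p169296) this is everything the line
proves; the two hypotheses are its declared open cores.
-/

noncomputable section

namespace Summit.AtomisticToContinuum.Crystallization.Theorems.PricedLinkCensusTruncatedCensusGap

open scoped BigOperators Classical
open Literature.MathematicalPhysics.StatisticalMechanics Literature.Geometry.DiscreteGeometry
open Summit.AtomisticToContinuum.Crystallization.Theses.PricedLinkCensus (TruncatedCensusGap)

/-- **`TruncatedCensusGap` from FAR and N2′** (registered sub-goal `truncatedCensusGap_of_far_of_localNearPricing`;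
the composition of the line `near-far-split`, sorry-free). -/
theorem truncatedCensusGap_of_far_of_localNearPricing : (∃ κ : ℝ, 0 < κ ∧ ∀ (N : ℕ) (y : Fin N → EuclideanSpace ℝ (Fin 3)), Function.Injective y → (N : ℝ) * (⨅ Q : Literature.MathematicalPhysics.StatisticalMechanics.PeriodicConfiguration 3, Q.energyPerParticle (fun r => min 1 (max 0 (4 - 2 * r)) * Literature.MathematicalPhysics.StatisticalMechanics.lennardJones r)) + κ * (Nat.card {i : Fin N // ¬ ∃ (a c : ℝ) (s : ℤ → ℤ) (g : EuclideanSpace ℝ (Fin 3) ≃ᵃⁱ[ℝ] EuclideanSpace ℝ (Fin 3)), 93 / 100 ≤ a ∧ a ≤ 51 / 50 ∧ 78 / 100 * a ≤ c ∧ c ≤ 86 / 100 * a ∧ Literature.MathematicalPhysics.StatisticalMechanics.IsHaggSeq s ∧ (∀ j k : Fin N, j ≠ k → dist (y j) (y i) ≤ 3 * a → a / 2 ≤ dist (y j) (y k)) ∧ (∀ j : Fin N, dist (y j) (y i) ≤ 3 * a → ∃ z ∈ Literature.MathematicalPhysics.StatisticalMechanics.barlowStacking a c s, dist (y j) (g z)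 ≤ a / 50) ∧ (∀ z ∈ Literature.MathematicalPhysics.StatisticalMechanics.barlowStacking a c s, dist (g z) (y i) ≤ 3 * a → ∃ j : Fin N, dist (y j) (g z) ≤ a / 50)} : ℝ) ≤ Literature.MathematicalPhysics.StatisticalMechanics.interactionEnergy (fun r => min 1 (max 0 (4 - 2 * r)) * Literature.MathematicalPhysics.StatisticalMechanics.lennardJones r) y) → (∃ κ C ρ : ℝ, 0 < κ ∧ ∃ F : (N : ℕ) → (Fin N → EuclideanSpace ℝ (Fin 3)) → Fin N → ℝ, (∀ (N : ℕ) (y : Fin N → EuclideanSpace ℝ (Fin 3)), Function.Injective y → ∑ i, F N y i = 0) ∧ (∀ (N : ℕ) (y : Fin N → EuclideanSpace ℝ (Fin 3)) (i : Fin N), Function.Injective y → |F N y i| ≤ C) ∧ ∀ (N : ℕ) (y : Fin N → EuclideanSpace ℝ (Fin 3)) (i : Fin N), Function.Injective y → (∀ i' : Fin N, dist (y i') (y i) ≤ ρ → ∃ (a c : ℝ) (s : ℤ → ℤ) (g : EuclideanSpace ℝ (Fin 3) ≃ᵃⁱ[ℝ] EuclideanSpace ℝ (Fin 3)), 93 /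 100 ≤ a ∧ a ≤ 51 / 50 ∧ 78 / 100 * a ≤ c ∧ c ≤ 86 / 100 * a ∧ Literature.MathematicalPhysics.StatisticalMechanics.IsHaggSeq s ∧ (∀ j k : Fin N, j ≠ k → dist (y j) (y i') ≤ 3 * a → a / 2 ≤ dist (y j) (y k)) ∧ (∀ j : Fin N, dist (y j) (y i') ≤ 3 * a → ∃ z ∈ Literature.MathematicalPhysics.StatisticalMechanics.barlowStacking a c s, dist (y j) (g z) ≤ a / 50) ∧ (∀ z ∈ Literature.MathematicalPhysics.StatisticalMechanics.barlowStacking a c s, dist (g z) (y i') ≤ 3 * a → ∃ j : Fin N, dist (y j) (g z) ≤ a / 50)) → (⨅ Q : Literature.MathematicalPhysics.StatisticalMechanics.PeriodicConfiguration 3, Q.energyPerParticle (fun r => min 1 (max 0 (4 - 2 * r)) * Literature.MathematicalPhysics.StatisticalMechanics.lennardJones r)) ≤ Literature.MathematicalPhysics.StatisticalMechanics.siteEnergy (fun r => min 1 (max 0 (4 - 2 * r)) * Literature.MathematicalPhysics.StatisticalMechanics.lennardJones r) y i / 2 + F N y i ∧ (¬ Literature.Geometry.DiscreteGeometry.IsChargeFree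 (1 / 100 : ℝ) y i → (⨅ Q : Literature.MathematicalPhysics.StatisticalMechanics.PeriodicConfiguration 3, Q.energyPerParticle (fun r => min 1 (max 0 (4 - 2 * r)) * Literature.MathematicalPhysics.StatisticalMechanics.lennardJones r)) + κ ≤ Literature.MathematicalPhysics.StatisticalMechanics.siteEnergy (fun r => min 1 (max 0 (4 - 2 * r)) * Literature.MathematicalPhysics.StatisticalMechanics.lennardJones r) y i / 2 + F N y i)) → Summit.AtomisticToContinuum.Crystallization.Theses.PricedLinkCensus.TruncatedCensusGap := by
  intro hFar' hLNP
  have hPrime : ∃ κ C : ℝ, 0 < κ ∧ ∀ (N : ℕ) (y : Fin N → EuclideanSpace ℝ (Fin 3)), Function.Injective y → ∀ S : Finset (Fin N), (∀ i : Fin N, i ∈ S ↔ ∃ (a c : ℝ) (s : ℤ → ℤ) (g : EuclideanSpace ℝ (Fin 3) ≃ᵃⁱ[ℝ] EuclideanSpace ℝ (Fin 3)), 93 / 100 ≤ a ∧ a ≤ 51 / 50 ∧ 78 / 100 * a ≤ c ∧ c ≤ 86 / 100 * a ∧ Literature.MathematicalPhysics.StatisticalMechanics.IsHaggSeq s ∧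 (∀ j k : Fin N, j ≠ k → dist (y j) (y i) ≤ 3 * a → a / 2 ≤ dist (y j) (y k)) ∧ (∀ j : Fin N, dist (y j) (y i) ≤ 3 * a → ∃ z ∈ Literature.MathematicalPhysics.StatisticalMechanics.barlowStacking a c s, dist (y j) (g z) ≤ a / 50) ∧ (∀ z ∈ Literature.MathematicalPhysics.StatisticalMechanics.barlowStacking a c s, dist (g z) (y i) ≤ 3 * a → ∃ j : Fin N, dist (y j) (g z) ≤ a / 50)) → (N : ℝ) * (⨅ Q : Literature.MathematicalPhysics.StatisticalMechanics.PeriodicConfiguration 3, Q.energyPerParticle (fun r => min 1 (max 0 (4 - 2 * r)) * Literature.MathematicalPhysics.StatisticalMechanics.lennardJones r)) + κ * (Nat.card {i : Fin N // ¬ Literature.Geometry.DiscreteGeometry.IsChargeFree (1 / 100 : ℝ) y i ∧ i ∈ S} : ℝ) ≤ Literature.MathematicalPhysics.StatisticalMechanics.interactionEnergy (fun r => min 1 (max 0 (4 - 2 * r)) * Literature.MathematicalPhysics.StatisticalMechanics.lennardJones r) y + C * ((Finset.univ \ S).card : ℝ) := stub_nearOfLocalPricing hLNP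
  have hNear' : ∃ κ C : ℝ, 0 < κ ∧ ∀ (N : ℕ) (y : Fin N → EuclideanSpace ℝ (Fin 3)), Function.Injective y → (N : ℝ) * (⨅ Q : Literature.MathematicalPhysics.StatisticalMechanics.PeriodicConfiguration 3, Q.energyPerParticle (fun r => min 1 (max 0 (4 - 2 * r)) * Literature.MathematicalPhysics.StatisticalMechanics.lennardJones r)) + κ * (Nat.card {i : Fin N // ¬ Literature.Geometry.DiscreteGeometry.IsChargeFree (1 / 100 : ℝ) y i ∧ ∃ (a c : ℝ) (s : ℤ → ℤ) (g : EuclideanSpace ℝ (Fin 3) ≃ᵃⁱ[ℝ] EuclideanSpace ℝ (Fin 3)), 93 / 100 ≤ a ∧ a ≤ 51 / 50 ∧ 78 / 100 * a ≤ c ∧ c ≤ 86 / 100 * a ∧ Literature.MathematicalPhysics.StatisticalMechanics.IsHaggSeq s ∧ (∀ j k : Fin N, j ≠ k → dist (y j) (y i) ≤ 3 * a → a / 2 ≤ dist (y j) (y k)) ∧ (∀ j : Fin N, dist (y j) (y i) ≤ 3 * a → ∃ z ∈ Literature.MathematicalPhysics.StatisticalMechanics.barlowStacking a c s, dist (y j)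 (g z) ≤ a / 50) ∧ (∀ z ∈ Literature.MathematicalPhysics.StatisticalMechanics.barlowStacking a c s, dist (g z) (y i) ≤ 3 * a → ∃ j : Fin N, dist (y j) (g z) ≤ a / 50)} : ℝ) ≤ Literature.MathematicalPhysics.StatisticalMechanics.interactionEnergy (fun r => min 1 (max 0 (4 - 2 * r)) * Literature.MathematicalPhysics.StatisticalMechanics.lennardJones r) y + C * (Nat.card {i : Fin N // ¬ ∃ (a c : ℝ) (s : ℤ → ℤ) (g : EuclideanSpace ℝ (Fin 3) ≃ᵃⁱ[ℝ] EuclideanSpace ℝ (Fin 3)), 93 / 100 ≤ a ∧ a ≤ 51 / 50 ∧ 78 / 100 * a ≤ c ∧ c ≤ 86 / 100 * a ∧ Literature.MathematicalPhysics.StatisticalMechanics.IsHaggSeq s ∧ (∀ j k : Fin N, j ≠ k → dist (y j) (y i) ≤ 3 * a → a / 2 ≤ dist (y j) (y k)) ∧ (∀ j : Fin N, dist (y j) (y i) ≤ 3 * a → ∃ z ∈ Literature.MathematicalPhysics.StatisticalMechanics.barlowStacking a c s, dist (y j) (g z) ≤ a / 50) ∧ (∀ z ∈ Literature.MathematicalPhysics.StatisticalMechanics.barlowStacking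 a c s, dist (g z) (y i) ≤ 3 * a → ∃ j : Fin N, dist (y j) (g z) ≤ a / 50)} : ℝ) := by
    revert hPrime
    intro h
    obtain ⟨κ, C, hκ, h⟩ := h
    refine ⟨κ, max C 0, hκ, fun N y hy => ?_⟩
    set S : Finset (Fin N) := Finset.univ.filter fun i => ∃ (a c : ℝ) (s : ℤ → ℤ) (g : EuclideanSpace ℝ (Fin 3) ≃ᵃⁱ[ℝ] EuclideanSpace ℝ (Fin 3)), 93 / 100 ≤ a ∧ a ≤ 51 / 50 ∧ 78 / 100 * a ≤ c ∧ c ≤ 86 / 100 * a ∧ Literature.MathematicalPhysics.StatisticalMechanics.IsHaggSeq s ∧ (∀ j k : Fin N, j ≠ k → dist (y j) (y i) ≤ 3 * a → a / 2 ≤ dist (y j) (y k)) ∧ (∀ j : Fin N, dist (y j) (y i) ≤ 3 * a → ∃ z ∈ Literature.MathematicalPhysics.StatisticalMechanics.barlowStacking a c s, dist (y j) (g z) ≤ a / 50) ∧ (∀ z ∈ Literature.MathematicalPhysics.StatisticalMechanics.barlowStacking a c s, dist (g z) (y i) ≤ 3 * a → ∃ j : Fin N, dist (y j) (g z) ≤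 a / 50) with hS
    have hmem : ∀ i : Fin N, i ∈ S ↔ ∃ (a c : ℝ) (s : ℤ → ℤ) (g : EuclideanSpace ℝ (Fin 3) ≃ᵃⁱ[ℝ] EuclideanSpace ℝ (Fin 3)), 93 / 100 ≤ a ∧ a ≤ 51 / 50 ∧ 78 / 100 * a ≤ c ∧ c ≤ 86 / 100 * a ∧ Literature.MathematicalPhysics.StatisticalMechanics.IsHaggSeq s ∧ (∀ j k : Fin N, j ≠ k → dist (y j) (y i) ≤ 3 * a → a / 2 ≤ dist (y j) (y k)) ∧ (∀ j : Fin N, dist (y j) (y i) ≤ 3 * a → ∃ z ∈ Literature.MathematicalPhysics.StatisticalMechanics.barlowStacking a c s, dist (y j) (g z) ≤ a / 50) ∧ (∀ z ∈ Literature.MathematicalPhysics.StatisticalMechanics.barlowStacking a c s, dist (g z) (y i) ≤ 3 * a → ∃ j : Fin N, dist (y j) (g z) ≤ a / 50) := fun i => by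
      rw [hS, Finset.mem_filter]; simp
    have h1 := h N y hy S hmem
    have e1 : (Nat.card {i : Fin N // ¬ Literature.Geometry.DiscreteGeometry.IsChargeFree (1 / 100 : ℝ) y i ∧ i ∈ S} : ℝ) =
        (Nat.card {i : Fin N // ¬ Literature.Geometry.DiscreteGeometry.IsChargeFree (1 / 100 : ℝ) y i ∧ ∃ (a c : ℝ) (s : ℤ → ℤ) (g : EuclideanSpace ℝ (Fin 3) ≃ᵃⁱ[ℝ] EuclideanSpace ℝ (Fin 3)), 93 / 100 ≤ a ∧ a ≤ 51 / 50 ∧ 78 / 100 * a ≤ c ∧ c ≤ 86 / 100 * a ∧ Literature.MathematicalPhysics.StatisticalMechanics.IsHaggSeq s ∧ (∀ j k : Fin N, j ≠ k → dist (y j) (y i) ≤ 3 * a → a / 2 ≤ dist (y j) (y k)) ∧ (∀ j : Fin N, dist (y j) (y i) ≤ 3 * a → ∃ z ∈ Literature.MathematicalPhysics.StatisticalMechanics.barlowStacking a c s, dist (y j) (g z) ≤ a / 50) ∧ (∀ z ∈ Literature.MathematicalPhysics.StatisticalMechanics.barlowStacking a c s, dist (g z) (y i) ≤ 3 * a → ∃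 j : Fin N, dist (y j) (g z) ≤ a / 50)} : ℝ) := by
      congr 1
      exact Nat.card_congr (Equiv.subtypeEquivRight fun i => by rw [hmem])
    have e2 : ((Finset.univ \ S).card : ℝ) = (Nat.card {i : Fin N // ¬ ∃ (a c : ℝ) (s : ℤ → ℤ) (g : EuclideanSpace ℝ (Fin 3) ≃ᵃⁱ[ℝ] EuclideanSpace ℝ (Fin 3)), 93 / 100 ≤ a ∧ a ≤ 51 / 50 ∧ 78 / 100 * a ≤ c ∧ c ≤ 86 / 100 * a ∧ Literature.MathematicalPhysics.StatisticalMechanics.IsHaggSeq s ∧ (∀ j k : Fin N, j ≠ k → dist (y j) (y i) ≤ 3 * a → a / 2 ≤ dist (y j) (y k)) ∧ (∀ j : Fin N, dist (y j) (y i) ≤ 3 * a → ∃ z ∈ Literature.MathematicalPhysics.StatisticalMechanics.barlowStacking a c s, dist (y j) (g z) ≤ a / 50) ∧ (∀ z ∈ Literature.MathematicalPhysics.StatisticalMechanics.barlowStacking a c s, dist (g z) (y i) ≤ 3 * a → ∃ j : Fin N, dist (y j) (g z) ≤ a / 50)} : ℝ) := by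
      rw [Nat.card_eq_fintype_card, Fintype.card_subtype]
      congr 1
      congr 1
      ext i
      simp only [Finset.mem_sdiff, Finset.mem_univ, true_and, Finset.mem_filter]
      rw [hmem]
    rw [e1, e2] at h1
    have hc : C * (Nat.card {i : Fin N // ¬ ∃ (a c : ℝ) (s : ℤ → ℤ) (g : EuclideanSpace ℝ (Fin 3) ≃ᵃⁱ[ℝ] EuclideanSpace ℝ (Fin 3)), 93 / 100 ≤ a ∧ a ≤ 51 / 50 ∧ 78 / 100 * a ≤ c ∧ c ≤ 86 / 100 * a ∧ Literature.MathematicalPhysics.StatisticalMechanics.IsHaggSeq s ∧ (∀ j k : Fin N, j ≠ k → dist (y j) (y i) ≤ 3 * a → a / 2 ≤ dist (y j) (y k)) ∧ (∀ j : Fin N, dist (y j) (y i) ≤ 3 * a → ∃ z ∈ Literature.MathematicalPhysics.StatisticalMechanics.barlowStacking a c s, dist (y j) (g z) ≤ a / 50) ∧ (∀ z ∈ Literature.MathematicalPhysics.StatisticalMechanics.barlowStacking a c s, dist (g z) (y i) ≤ 3 * a → ∃ j : Fin N, dist (y j) (g z) ≤ a / 50)} : ℝ) ≤ max C 0 * (Nat.card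 {i : Fin N // ¬ ∃ (a c : ℝ) (s : ℤ → ℤ) (g : EuclideanSpace ℝ (Fin 3) ≃ᵃⁱ[ℝ] EuclideanSpace ℝ (Fin 3)), 93 / 100 ≤ a ∧ a ≤ 51 / 50 ∧ 78 / 100 * a ≤ c ∧ c ≤ 86 / 100 * a ∧ Literature.MathematicalPhysics.StatisticalMechanics.IsHaggSeq s ∧ (∀ j k : Fin N, j ≠ k → dist (y j) (y i) ≤ 3 * a → a / 2 ≤ dist (y j) (y k)) ∧ (∀ j : Fin N, dist (y j) (y i) ≤ 3 * a → ∃ z ∈ Literature.MathematicalPhysics.StatisticalMechanics.barlowStacking a c s, dist (y j) (g z) ≤ a / 50) ∧ (∀ z ∈ Literature.MathematicalPhysics.StatisticalMechanics.barlowStacking a c s, dist (g z) (y i) ≤ 3 * a → ∃ j : Fin N, dist (y j) (g z) ≤ a / 50)} : ℝ) :=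
      mul_le_mul_of_nonneg_right (le_max_left _ _) (Nat.cast_nonneg _)
    linarith

  obtain ⟨κ₂, hκ₂, hFar⟩ := hFar'
  obtain ⟨κ₁, C, hκ₁, hNear⟩ := hNear'
  -- the price
  set C' : ℝ := max C 0 with hC'
  have hC'0 : 0 ≤ C' := le_max_right _ _
  have hCC' : C ≤ C' := le_max_left _ _
  have hS : 0 < κ₁ + κ₂ + C' := by linarith
  refine ⟨κ₁ * κ₂ / (κ₁ + κ₂ + C'), div_pos (mul_pos hκ₁ hκ₂) hS, fun N y hy => ?_⟩
  have e1 := hFar N y hy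
  have e2 := hNear N y hy
  -- abbreviations
  set E : ℝ := Literature.MathematicalPhysics.StatisticalMechanics.interactionEnergy (fun r => min 1 (max 0 (4 - 2 * r)) * Literature.MathematicalPhysics.StatisticalMechanics.lennardJones r) y with hE
  set estar : ℝ := (⨅ Q : Literature.MathematicalPhysics.StatisticalMechanics.PeriodicConfiguration 3, Q.energyPerParticle (fun r => min 1 (max 0 (4 - 2 * r)) * Literature.MathematicalPhysics.StatisticalMechanics.lennardJones r)) with hestar
  set near : Fin N → Prop := fun i => ∃ (a c : ℝ) (s : ℤ → ℤ) (g : EuclideanSpace ℝ (Fin 3) ≃ᵃⁱ[ℝ] EuclideanSpace ℝ (Fin 3)), 93 / 100 ≤ a ∧ a ≤ 51 / 50 ∧ 78 / 100 * a ≤ c ∧ c ≤ 86 / 100 * a ∧ Literature.MathematicalPhysics.StatisticalMechanics.IsHaggSeq s ∧ (∀ j k : Fin N, j ≠ k → dist (y j) (y i) ≤ 3 * a → a / 2 ≤ dist (y j) (y k)) ∧ (∀ j : Fin N, dist (y j) (y i) ≤ 3 * a → ∃ z ∈ Literature.MathematicalPhysics.StatisticalMechanics.barlowStacking a c s, dist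 (y j) (g z) ≤ a / 50) ∧ (∀ z ∈ Literature.MathematicalPhysics.StatisticalMechanics.barlowStacking a c s, dist (g z) (y i) ≤ 3 * a → ∃ j : Fin N, dist (y j) (g z) ≤ a / 50) with hnear
  -- the three finsets
  set Ch := Finset.univ.filter fun i : Fin N => ¬ IsChargeFree (1 / 100 : ℝ) y i with hCh
  set Fr := Finset.univ.filter fun i : Fin N => ¬ near i with hFr
  set Nc := Finset.univ.filter fun i : Fin N => ¬ IsChargeFree (1 / 100 : ℝ) y i ∧ near i with hNc
  have hChNat : (Nat.card {i : Fin N // ¬ IsChargeFree (1 / 100 : ℝ) y i} : ℝ) = Ch.card := by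
    rw [Nat.card_eq_fintype_card, Fintype.card_subtype]
  have hFrNat : (Nat.card {i : Fin N // ¬ near i} : ℝ) = Fr.card := by
    rw [Nat.card_eq_fintype_card, Fintype.card_subtype]
  have hNcNat : (Nat.card {i : Fin N // ¬ IsChargeFree (1 / 100 : ℝ) y i ∧ near i} : ℝ) = Nc.card := by
    rw [Nat.card_eq_fintype_card, Fintype.card_subtype]
  -- (1) a charged site is near-and-charged or far
  have hcover : Ch ⊆ Nc ∪ Fr := by
    intro i hi
    have hci : ¬ IsChargeFree (1 / 100 : ℝ) y i := (Finset.mem_filter.1 hi).2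
    by_cases hn : near i
    · exact Finset.mem_union_left _ (Finset.mem_filter.2 ⟨Finset.mem_univ _, hci, hn⟩)
    · exact Finset.mem_union_right _ (Finset.mem_filter.2 ⟨Finset.mem_univ _, hn⟩)
  have hcard : (Ch.card : ℝ) ≤ Nc.card + Fr.card := by
    exact_mod_cast (Finset.card_le_card hcover).trans (Finset.card_union_le Nc Fr)
  -- (2) the two hypotheses in finset form
  change (N : ℝ) * estar + κ₂ * (Nat.card {i : Fin N // ¬ near i} : ℝ) ≤ E at e1
  change (N : ℝ) * estar + κ₁ * (Nat.card {i : Fin N // ¬ IsChargeFree (1 / 100 : ℝ) y i ∧ near i} : ℝ)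
      ≤ E + C * (Nat.card {i : Fin N // ¬ near i} : ℝ) at e2
  rw [hFrNat] at e1
  rw [hNcNat, hFrNat] at e2
  change (N : ℝ) * estar + κ₁ * κ₂ / (κ₁ + κ₂ + C') *
      (Nat.card {i : Fin N // ¬ IsChargeFree (1 / 100 : ℝ) y i} : ℝ) ≤ E
  rw [hChNat]
  have hF0 : (0 : ℝ) ≤ Fr.card := Nat.cast_nonneg _
  have hN0 : (0 : ℝ) ≤ Nc.card := Nat.cast_nonneg _
  have hX1 : κ₂ * (Fr.card : ℝ) ≤ E - N * estar := by linarith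
  have hX2 : κ₁ * (Nc.card : ℝ) ≤ (E - N * estar) + C' * Fr.card := by
    have : C * (Fr.card : ℝ) ≤ C' * Fr.card := mul_le_mul_of_nonneg_right hCC' hF0
    linarith
  have key : κ₁ * κ₂ * (Ch.card : ℝ) ≤ (κ₁ + κ₂ + C') * (E - N * estar) := by
    have a1 : κ₁ * κ₂ * (Ch.card : ℝ) ≤ κ₁ * κ₂ * (Nc.card + Fr.card) :=
      mul_le_mul_of_nonneg_left hcard (mul_pos hκ₁ hκ₂).le
    have a2 : κ₂ * (κ₁ * (Nc.card : ℝ)) ≤ κ₂ * ((E - N * estar) + C' * Fr.card) :=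
      mul_le_mul_of_nonneg_left hX2 hκ₂.le
    have a3 : κ₁ * (κ₂ * (Fr.card : ℝ)) ≤ κ₁ * (E - N * estar) :=
      mul_le_mul_of_nonneg_left hX1 hκ₁.le
    have a4 : C' * (κ₂ * (Fr.card : ℝ)) ≤ C' * (E - N * estar) :=
      mul_le_mul_of_nonneg_left hX1 hC'0
    nlinarith
  have hfin : κ₁ * κ₂ / (κ₁ + κ₂ + C') * (Ch.card : ℝ) ≤ E - N * estar := by
    rw [div_mul_eq_mul_div, div_le_iff₀ hS]
    linarith
  linarith

end Summit.AtomisticToContinuum.Crystallization.Theorems.PricedLinkCensusTruncatedCensusGap
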